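import Summits.Ventures.PercRepro.S1TriangleRecursionNineSix

/-!
# PercRepro — TWO SHAPES OF THE `(7, 6)` CELL WITH A LINE AS A PART: `U_{2,5} ⊕ (rank 5 on 8)` AND
`(rank 5 on 7) ⊕ U_{2,6}` (p2, gen 28; SUBCLAIM-S1 §6.10 (xvii)(o); the `(7, 6)` capstone is `S1SevenSixSeparators`)

Φ(7, 4) = 14/5.
* `U_{2,5} ⊕ N` with `N` of rank `5` on `8` points (nullities `3 + 3`): `#U ≤ 20 N_N(5, 2) + 5 N_N(5, 3)`, Theorem N
  at `(5, 2)` and Theorem M at `(5, 3)` on `N`: `Φ · #U ≤ 16.8 (f_N(3) + f_N(4)) + 11.2 f_N(4)`;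
  `#Y ≥ 26 (f_N(3) + f_N(4)) + 5 f_N(4)`. No coloop hypothesis on `N`.
* `N ⊕ U_{2,6}` with `N` of rank `5` on `7` points (nullities `2 + 4`): `#U ≤ 50 N_N(5, 2)`, Theorem N at `(5, 2)`:
  `Φ · #U ≤ 42 (f_N(3) + f_N(4)) ≤ 57 (f_N(3) + f_N(4)) ≤ #Y`.
Nothing is claimed about any cell.

* `ncard_profileSet_two_two_le_of_ncard` — `N_M(2, 2) ≤ C(n, 2) + C(n, 3) + … + C(n, n − 2)` for a rank-`2` part;
* `c025_seven_four_disjointSum_line_five_rank_five_eight`, `c025_seven_four_disjointSum_rank_five_seven_line_six`.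
Axioms: standard.
-/

open scoped Matroid

namespace PercRepro

namespace S1

open Set

variable {α : Type}

/-- In a rank-`2` matroid, a spanning set with a rank-`2` complement has between `2` and `n − 2` points. -/
theorem profileSet_two_two_subset (M : Matroid α) [M.Finite] :
    profileSet M 2 2 ⊆ {A : Set α | A ⊆ M.E ∧ 2 ≤ A.ncard ∧ A.ncard + 2 ≤ M.E.ncard} := by
  rintro A ⟨hAE, hA2, hAc⟩
  have hAfin : A.Finite := M.ground_finite.subset hAE
  have h1 : ((2 : ℕ) : ℕ∞) ≤ (A.ncard : ℕ∞) := by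
    rw [← hA2, hAfin.cast_ncard_eq]; exact M.eRk_le_encard A
  have h2 : ((2 : ℕ) : ℕ∞) ≤ ((M.E \ A).ncard : ℕ∞) := by
    rw [← hAc, (M.ground_finite.subset sdiff_subset).cast_ncard_eq]; exact M.eRk_le_encard _
  have h3 : A.ncard + (M.E \ A).ncard = M.E.ncard := by
    rw [← ncard_union_eq disjoint_sdiff_right hAfin (M.ground_finite.subset sdiff_subset), union_sdiff_cancel hAE]
  have h1' : 2 ≤ A.ncard := by exact_mod_cast h1
  have h2' : 2 ≤ (M.E \ A).ncard := by exact_mod_cast h2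
  exact ⟨hAE, h1', by omega⟩

/-- `N_M(2, 2) ≤ 20` on `5` points and `≤ 50` on `6` points. -/
theorem ncard_profileSet_two_two_le_five (M : Matroid α) [M.Finite] (hE : M.E.ncard = 5) :
    (profileSet M 2 2).ncard ≤ 20 := by
  have hf : ∀ k : ℕ, {A : Set α | A ⊆ M.E ∧ A.ncard = k}.Finite := fun k =>
    M.ground_finite.finite_subsets.subset (fun _ hA => hA.1)
  have hsub : profileSet M 2 2 ⊆ {A : Set α | A ⊆ M.E ∧ A.ncard = 2} ∪ {A : Set α | A ⊆ M.E ∧ A.ncard = 3} := by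
    intro A hA
    obtain ⟨hAE, h2, h3⟩ := profileSet_two_two_subset M hA
    rw [hE] at h3
    rcases Nat.lt_or_ge A.ncard 3 with h | h
    · left; exact ⟨hAE, by omega⟩
    · right; exact ⟨hAE, by omega⟩
  have h := ncard_le_ncard hsub ((hf 2).union (hf 3))
  refine h.trans ((ncard_union_le _ _).trans ?_)
  rw [ncard_setOf_subset_ncard_eq M.ground_finite 2, ncard_setOf_subset_ncard_eq M.ground_finite 3, hE]
  decide

/-- `N(2, 2) ≤ 6` for a part on `6` points of rank `2`. -/
theorem ncard_profileSet_two_two_le_six (M : Matroid α) [M.Finite] (hE : M.E.ncard = 6) :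
    (profileSet M 2 2).ncard ≤ 50 := by
  have hf : ∀ k : ℕ, {A : Set α | A ⊆ M.E ∧ A.ncard = k}.Finite := fun k =>
    M.ground_finite.finite_subsets.subset (fun _ hA => hA.1)
  have hsub : profileSet M 2 2 ⊆ {A : Set α | A ⊆ M.E ∧ A.ncard = 2} ∪ {A : Set α | A ⊆ M.E ∧ A.ncard = 3} ∪
      {A : Set α | A ⊆ M.E ∧ A.ncard = 4} := by
    intro A hA
    obtain ⟨hAE, h2, h3⟩ := profileSet_two_two_subset M hA
    rw [hE] at h3
    rcases Nat.lt_or_ge A.ncard 3 with h | h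
    · left; left; exact ⟨hAE, by omega⟩
    rcases Nat.lt_or_ge A.ncard 4 with h' | h'
    · left; right; exact ⟨hAE, by omega⟩
    · right; exact ⟨hAE, by omega⟩
  have h := ncard_le_ncard hsub (((hf 2).union (hf 3)).union (hf 4))
  refine h.trans ((ncard_union_le _ _).trans ?_)
  refine (Nat.add_le_add_right (ncard_union_le _ _) _).trans ?_
  rw [ncard_setOf_subset_ncard_eq M.ground_finite 2, ncard_setOf_subset_ncard_eq M.ground_finite 3,
    ncard_setOf_subset_ncard_eq M.ground_finite 4, hE]
  decide

/-- The arithmetic of `U_{2,5} ⊕ (rank 5 on 8)` at `(7, 4)`. -/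
theorem consumer_arith_line_five_rank_five_eight {u y P2 P3 f3 f4 : ℚ} (hU : u ≤ 20 * P2 + 5 * P3)
    (h52 : 10 / 3 * P2 ≤ f3 + f4) (h53 : 5 / 4 * P3 ≤ f4) (hY : 26 * (f3 + f4) + 5 * f4 ≤ y) (hf3 : 0 ≤ f3)
    (hf4 : 0 ≤ f4) : 14 / 5 * u ≤ y := by
  linarith

/-- **`U_{2,5} ⊕ N` at `(7, 4)`**, `N` of rank `5` on `8` points (any finite `N`; `M` of rank `2` on `5` points with
all pairs of rank `2`). -/
theorem c025_seven_four_disjointSum_line_five_rank_five_eight (M N : Matroid α) [M.Finite] [N.Finite]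
    (h : Disjoint M.E N.E) (hM : M.eRank = ((2 : ℕ) : ℕ∞)) (hME : M.E.ncard = 5)
    (hpairs : ∀ e ∈ M.E, ∀ f ∈ M.E, e ≠ f → M.eRk {e, f} = 2) (hN : N.eRank = ((5 : ℕ) : ℕ∞))
    (hNE : N.E.ncard = 8) :
    phiK 7 4 * ({A : Set α | A ⊆ (M.disjointSum N h).E ∧ (M.disjointSum N h).eRk A = ((7 : ℕ) : ℕ∞) ∧
        (M.disjointSum N h).eRk ((M.disjointSum N h).E \ A) = ((4 : ℕ) : ℕ∞)}.ncard : ℚ) ≤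
      ({A : Set α | A ⊆ (M.disjointSum N h).E ∧ ((4 : ℕ) : ℕ∞) < (M.disjointSum N h).eRk A ∧
        (M.disjointSum N h).eRk A < ((7 : ℕ) : ℕ∞)}.ncard : ℚ) := by
  have hU : {A : Set α | A ⊆ (M.disjointSum N h).E ∧ (M.disjointSum N h).eRk A = ((7 : ℕ) : ℕ∞) ∧
      (M.disjointSum N h).eRk ((M.disjointSum N h).E \ A) = ((4 : ℕ) : ℕ∞)}.ncard ≤
      20 * (profileSet N 5 2).ncard + 5 * (profileSet N 5 3).ncard := by
    rw [disjointSum_ncard_U_eq_finsum M N h 7 4, finsum_mem_coe_finset]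
    rw [Finset.sum_eq_add_of_mem (2, 2) (2, 1) (by decide) (by decide) (by decide) ?_]
    · dsimp only
      show (profileSet M 2 2).ncard * (profileSet N 5 2).ncard + (profileSet M 2 1).ncard * (profileSet N 5 3).ncard ≤ _
      have h22 := ncard_profileSet_two_two_le_five M hME
      have h21 := ncard_profileSet_top_one_le_of_pairs' hpairs 2
      rw [hME] at h21
      exact Nat.add_le_add (Nat.mul_le_mul_right _ h22) (Nat.mul_le_mul_right _ h21)
    · rintro ⟨a, b⟩ hmem ⟨hne1, hne2⟩
      rw [Finset.mem_product, Finset.mem_range, Finset.mem_range] at hmem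
      dsimp only
      rcases Nat.lt_or_ge 2 a with ha | ha
      · rw [profileSet_eq_empty_of_eRank_lt M hM ha b, ncard_empty, zero_mul]
      rcases Nat.lt_or_ge a 2 with ha' | ha'
      · have h7a : 5 < 7 - a := by omega
        rw [profileSet_eq_empty_of_eRank_lt N hN h7a (4 - b), ncard_empty, mul_zero]
      have ha2 : a = 2 := by omega
      subst ha2
      rw [show (7 : ℕ) - 2 = 5 from rfl]
      rcases Nat.lt_or_ge b 1 with hb | hb
      · -- `b = 0`: `N_N(5, 4) = ∅` on `8` points
        have hb0 : b = 0 := by omega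
        subst hb0
        rw [profileSet_eq_empty_of_ncard_lt N (by rw [hNE]; norm_num : N.E.ncard < 5 + (4 - 0)), ncard_empty,
          mul_zero]
      · have hb3 : 2 < b := by
          rcases Nat.lt_or_ge b 3 with hb3 | hb3
          · exfalso
            rcases Nat.lt_or_ge b 2 with hb2 | hb2
            · exact hne2 (by congr 1; omega)
            · exact hne1 (by congr 1; omega)
          · omega
        rw [profileSet_eq_empty_of_eRank_lt_snd M hM hb3 2, ncard_empty, zero_mul]
  have hY : 26 * ((rankSet N 3).ncard + (rankSet N 4).ncard) + 5 * (rankSet N 4).ncard ≤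
      {A : Set α | A ⊆ (M.disjointSum N h).E ∧ ((4 : ℕ) : ℕ∞) < (M.disjointSum N h).eRk A ∧
        (M.disjointSum N h).eRk A < ((7 : ℕ) : ℕ∞)}.ncard := by
    rw [disjointSum_ncard_Y_eq_finsum M N h 7 4, finsum_mem_coe_finset]
    have hsub : ({(1, 4), (2, 3), (2, 4)} : Finset (ℕ × ℕ)) ⊆
        (Finset.range 7 ×ˢ Finset.range 7).filter (fun x : ℕ × ℕ => 4 < x.1 + x.2 ∧ x.1 + x.2 < 7) := by
      decide
    refine le_trans ?_ (Finset.sum_le_sum_of_subset hsub)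
    rw [Finset.sum_insert (by decide), Finset.sum_insert (by decide), Finset.sum_singleton]
    dsimp only
    have f2 : 26 ≤ (rankSet M 2).ncard := by
      have := ncard_rankSet_two_ge_of_rank_two M hM hpairs
      rwa [hME, show 2 ^ 5 - 1 - 5 = 26 by decide] at this
    have f1 : 5 ≤ (rankSet M 1).ncard := by
      have := ncard_le_ncard_rankSet_one_of_pairs hpairs (by omega)
      rwa [hME] at this
    have e14 := Nat.mul_le_mul_right (rankSet N 4).ncard f1
    have e23 := Nat.mul_le_mul_right (rankSet N 3).ncard f2
    have e24 := Nat.mul_le_mul_right (rankSet N 4).ncard f2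
    linarith
  have h52 : (10 / 3 : ℚ) * ((profileSet N 5 2).ncard : ℚ) ≤
      ((rankSet N 3).ncard : ℚ) + ((rankSet N 4).ncard : ℚ) := by
    have h0 := ThmN.c025_two_all N 5 (by norm_num)
    unfold ThmN.RLS at h0
    rw [phiK_five_two, ySet_eq_rankSet_union_of_eq N (q := 2) (p := 5) (k := 3) (k' := 4) rfl rfl rfl,
      ncard_union_eq (rankSet_disjoint_of_ne N (by norm_num)) (rankSet_finite N 3) (rankSet_finite N 4)] at h0
    push_cast at h0
    exact h0
  have h53 : (5 / 4 : ℚ) * ((profileSet N 5 3).ncard : ℚ) ≤ ((rankSet N 4).ncard : ℚ) := by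
    have h0 := ThmN.RLS_of_ncard_eq N (p := 5) (q := 3) hNE
    unfold ThmN.RLS at h0
    rw [ThmO.phiK_five_three, ySet_eq_rankSet_of_eq N (q := 3) (p := 5) (k := 4) rfl rfl] at h0
    exact h0
  rw [phiK_seven_four]
  have hU' : (({A : Set α | A ⊆ (M.disjointSum N h).E ∧ (M.disjointSum N h).eRk A = ((7 : ℕ) : ℕ∞) ∧
      (M.disjointSum N h).eRk ((M.disjointSum N h).E \ A) = ((4 : ℕ) : ℕ∞)}.ncard : ℕ) : ℚ) ≤
      20 * ((profileSet N 5 2).ncard : ℚ) + 5 * ((profileSet N 5 3).ncard : ℚ) := by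
    exact_mod_cast hU
  have hY' : 26 * (((rankSet N 3).ncard : ℚ) + ((rankSet N 4).ncard : ℚ)) + 5 * ((rankSet N 4).ncard : ℚ) ≤
      (({A : Set α | A ⊆ (M.disjointSum N h).E ∧ ((4 : ℕ) : ℕ∞) < (M.disjointSum N h).eRk A ∧
        (M.disjointSum N h).eRk A < ((7 : ℕ) : ℕ∞)}.ncard : ℕ) : ℚ) := by
    exact_mod_cast hY
  exact consumer_arith_line_five_rank_five_eight hU' h52 h53 hY' (Nat.cast_nonneg _) (Nat.cast_nonneg _)

/-- The arithmetic of `(rank 5 on 7) ⊕ U_{2,6}` at `(7, 4)`. -/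
theorem consumer_arith_rank_five_seven_line_six {u y P T : ℚ} (hU : u ≤ 50 * P) (h52 : 10 / 3 * P ≤ T)
    (hY : 57 * T ≤ y) (hT : 0 ≤ T) : 14 / 5 * u ≤ y := by
  linarith

/-- **`M ⊕ U_{2,6}` at `(7, 4)`**, `M` of rank `5` on `7` points (any finite `M`), `N` of rank `2` on `6` points with
all pairs of rank `2`. -/
theorem c025_seven_four_disjointSum_rank_five_seven_line_six (M N : Matroid α) [M.Finite] [N.Finite]
    (h : Disjoint M.E N.E) (hM : M.eRank = ((5 : ℕ) : ℕ∞)) (hME : M.E.ncard = 7) (hN : N.eRank = ((2 : ℕ) : ℕ∞))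
    (hNE : N.E.ncard = 6) (hpairs : ∀ e ∈ N.E, ∀ f ∈ N.E, e ≠ f → N.eRk {e, f} = 2) :
    phiK 7 4 * ({A : Set α | A ⊆ (M.disjointSum N h).E ∧ (M.disjointSum N h).eRk A = ((7 : ℕ) : ℕ∞) ∧
        (M.disjointSum N h).eRk ((M.disjointSum N h).E \ A) = ((4 : ℕ) : ℕ∞)}.ncard : ℚ) ≤
      ({A : Set α | A ⊆ (M.disjointSum N h).E ∧ ((4 : ℕ) : ℕ∞) < (M.disjointSum N h).eRk A ∧
        (M.disjointSum N h).eRk A < ((7 : ℕ) : ℕ∞)}.ncard : ℚ) := by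
  have hU : {A : Set α | A ⊆ (M.disjointSum N h).E ∧ (M.disjointSum N h).eRk A = ((7 : ℕ) : ℕ∞) ∧
      (M.disjointSum N h).eRk ((M.disjointSum N h).E \ A) = ((4 : ℕ) : ℕ∞)}.ncard ≤
      50 * (profileSet M 5 2).ncard := by
    rw [disjointSum_ncard_U_eq_finsum M N h 7 4, finsum_mem_coe_finset]
    rw [Finset.sum_eq_single_of_mem (5, 2) (by decide) ?_]
    · dsimp only
      show (profileSet M 5 2).ncard * (profileSet N 2 2).ncard ≤ _
      have h22 := ncard_profileSet_two_two_le_six N hNE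
      calc (profileSet M 5 2).ncard * (profileSet N 2 2).ncard ≤ (profileSet M 5 2).ncard * 50 :=
            Nat.mul_le_mul_left _ h22
        _ = 50 * (profileSet M 5 2).ncard := by ring
    · rintro ⟨a, b⟩ hmem hne
      rw [Finset.mem_product, Finset.mem_range, Finset.mem_range] at hmem
      dsimp only
      rcases Nat.lt_or_ge 5 a with ha | ha
      · rw [profileSet_eq_empty_of_eRank_lt M hM ha b, ncard_empty, zero_mul]
      rcases Nat.lt_or_ge a 5 with ha' | ha'
      · have h7a : 2 < 7 - a := by omega
        rw [profileSet_eq_empty_of_eRank_lt N hN h7a (4 - b), ncard_empty, mul_zero]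
      have ha5 : a = 5 := by omega
      subst ha5
      rw [show (7 : ℕ) - 5 = 2 from rfl]
      rcases Nat.lt_or_ge b 2 with hb | hb
      · -- `N_N(2, 4 − b) = ∅`: a complement of rank `≥ 3` in a matroid of rank `2`
        rw [profileSet_eq_empty_of_eRank_lt_snd N hN (by omega) 2, ncard_empty, mul_zero]
      · have hb3 : 2 < b := by
          rcases Nat.lt_or_ge b 3 with hb3 | hb3
          · exfalso; exact hne (by congr 1; omega)
          · omega
        -- `N_M(5, b) = ∅` for `b ≥ 3` on `7` points: the complement would need `≥ 3` points beside `5`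
        have h7 : M.E.ncard < 5 + b := by rw [hME]; omega
        rw [profileSet_eq_empty_of_ncard_lt M h7, ncard_empty, zero_mul]
  have hY : 57 * ((rankSet M 3).ncard + (rankSet M 4).ncard) ≤
      {A : Set α | A ⊆ (M.disjointSum N h).E ∧ ((4 : ℕ) : ℕ∞) < (M.disjointSum N h).eRk A ∧
        (M.disjointSum N h).eRk A < ((7 : ℕ) : ℕ∞)}.ncard := by
    rw [disjointSum_ncard_Y_eq_finsum M N h 7 4, finsum_mem_coe_finset]
    have hsub : ({(3, 2), (4, 2)} : Finset (ℕ × ℕ)) ⊆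
        (Finset.range 7 ×ˢ Finset.range 7).filter (fun x : ℕ × ℕ => 4 < x.1 + x.2 ∧ x.1 + x.2 < 7) := by
      decide
    refine le_trans ?_ (Finset.sum_le_sum_of_subset hsub)
    rw [Finset.sum_insert (by decide), Finset.sum_singleton]
    dsimp only
    have g2 : 57 ≤ (rankSet N 2).ncard := by
      have := ncard_rankSet_two_ge_of_rank_two N hN hpairs
      rwa [hNE, show 2 ^ 6 - 1 - 6 = 57 by decide] at this
    have e32 := Nat.mul_le_mul_left (rankSet M 3).ncard g2
    have e42 := Nat.mul_le_mul_left (rankSet M 4).ncard g2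
    linarith
  have h52 : (10 / 3 : ℚ) * ((profileSet M 5 2).ncard : ℚ) ≤
      ((rankSet M 3).ncard : ℚ) + ((rankSet M 4).ncard : ℚ) := by
    have h0 := ThmN.c025_two_all M 5 (by norm_num)
    unfold ThmN.RLS at h0
    rw [phiK_five_two, ySet_eq_rankSet_union_of_eq M (q := 2) (p := 5) (k := 3) (k' := 4) rfl rfl rfl,
      ncard_union_eq (rankSet_disjoint_of_ne M (by norm_num)) (rankSet_finite M 3) (rankSet_finite M 4)] at h0
    push_cast at h0
    exact h0
  rw [phiK_seven_four]
  have hU' : (({A : Set α | A ⊆ (M.disjointSum N h).E ∧ (M.disjointSum N h).eRk A = ((7 : ℕ) : ℕ∞) ∧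
      (M.disjointSum N h).eRk ((M.disjointSum N h).E \ A) = ((4 : ℕ) : ℕ∞)}.ncard : ℕ) : ℚ) ≤
      50 * ((profileSet M 5 2).ncard : ℚ) := by
    exact_mod_cast hU
  have hY' : 57 * (((rankSet M 3).ncard : ℚ) + ((rankSet M 4).ncard : ℚ)) ≤
      (({A : Set α | A ⊆ (M.disjointSum N h).E ∧ ((4 : ℕ) : ℕ∞) < (M.disjointSum N h).eRk A ∧
        (M.disjointSum N h).eRk A < ((7 : ℕ) : ℕ∞)}.ncard : ℕ) : ℚ) := by
    exact_mod_cast hY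
  have hT : (0 : ℚ) ≤ ((rankSet M 3).ncard : ℚ) + ((rankSet M 4).ncard : ℚ) := by positivity
  exact consumer_arith_rank_five_seven_line_six hU' h52 hY' hT

end S1

end PercRepro
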